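/-
Copyright (c) 2026 the pub-hodgecm-mathlib formalisation cell (harness21).  Prover seat hodgecm-mathlib-K2E1-p12 (g2), Track B ∕ K2-LIT, h413 = `stmt-HodgeConjecture-24833`,
line `K2_E1_TraceFormulaBeta`, (225) FILE β2 of the dealer K2E1-plan (g7) — the `N = 2` twin (`U(1,1)∕CM`, lower domain `{½ < re ∧ im < 0}`, tube `1 < re`, shift `− 1`) of ★ p860150
`K2E1MaassSelbergDiagonalLowerCMThree` (K2E4-p14 (g9)): the diagonal identity on the LOWER half-plane by reflection at the pairing level.  Its N-free §3 (the reflection principle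
`conj_apply_conj_eq_of_eventuallyEq` ∕ `im_apply_ofReal_eq_zero`) is REUSED BY NAME from ★ p860150, not restated.
-/
import Summits.HodgeConjecture.HodgeConjecture.Theorems.K2E1MaassSelbergDiagonalFourTermCMTwo   -- THIS SEAT (β1): `diag_eq_fourTerm_of_pairing_on'` at `N = 2`; brings ★ OnBoxesCMTwo, ★ PairingContinuedCMTwo (`exists_fourTerm_tube_cm_two`), ★ CMTwo §0∕§1
import HarnessLib

/-!
# h413 ∕ Track B «K2-LIT», (MS-real)₂ — `K2E1MaassSelbergDiagonalLowerCMTwo`: the diagonal Maass–Selberg identity of `U(1,1)∕CM` on a LOWER-half-plane domain, by reflection —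
# the `N = 2` twin of ★ p860150

Cell `pub/hodgecm-mathlib`, crux H413 = `stmt-HodgeConjecture-24833`, route `HCCMUnconditional`; prover seat `hodgecm-mathlib-K2E1-p12` (g2), deal (225) of the dealer K2E1-plan (g7)
(the (MS-real)₂ chain: FILE α ★ p860161 → β1 → β2 (this file) → β3 `K2E1SphericalEisensteinL2BoundCMTwo` → γ).  THEOREMS ONLY (no `def` ∕ `instance` ∕ `notation` ∕ named-fact
hypothesis ∕ `sorry`); lane `--kind proof --supports stmt-HodgeConjecture-24833 --as helper` (count-neutral; closes no socket).  The byte-for-byte `N = 2` twin of ★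
`K2E1MaassSelbergDiagonalLowerCMThree` with `3 ↦ 2`, `{1 < re ∧ im < 0} ↦ {½ < re ∧ im < 0}`, tube `2 < re ↦ 1 < re`, shift `− 2 ↦ − 1` (`map_ofNat ↦ map_one` in §1).
THE MATHEMATICS [MoeglinWaldspurger1995, IV.2.3, IV.3.12 (a); Arthur1980TraceFormulaII, §4].  The reflected pairing `Φ′(u, u′) := ⟪F ū, F ū′⟫` on `D = conj⁻¹D₁ ⊆ D⁺ = {½ < re ∧ 0 < im}` is
holomorphic in `u`, anti-holomorphic in `u′` (★ `pairing_of_differentiableOn` with the clauses swapped) and equals `conj R(ū, ū′; c̃) = R(u, u′; conj ∘ c̃ ∘ conj)` on the reflected boxes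
(★ `exists_fourTerm_tube_cm_two` + §1), so β1's ★ `diag_eq_fourTerm_of_pairing_on'` gives the diagonal identity on `D`, i.e. `‖F ū‖² = R(u, u; conj (c̃ ū))` for `ū ∈ D₁`.
* §1 `conj_fourTerm_two` — `conj R(ū, ū′; c) = R(u, u′; conj ∘ c ∘ conj)` (pure algebra, shift `− 1`).
* §2 **`normSq_family_eq_fourTerm_lower_on'`** = β1's `normSq_family_eq_fourTerm_on'` binders VERBATIM except `hD₁sub : D₁ ⊆ {½ < re ∧ im < 0}` ⟹
  `∃ cμ K > 0, ∀ u, conj u ∈ D₁ → (‖F (conj u)‖² : ℂ) = R(u, u; conj (c (conj u)))`.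
The reflection principle for the scalar (`c(z̄) = conj c(z)` ⟹ `c` real on the real trace) is ★ p860150 §3, rank-free — cite `K2E1MaassSelbergDiagonalLowerCMThree.conj_apply_conj_eq_of_eventuallyEq`
∕ `im_apply_ofReal_eq_zero` by name.
HONEST LABEL.  Count-neutral helper; proves no printed statement; conditional on the `_on'` binders; HC_CM is proved only modulo the 7 printed citations (2 remaining named inputs: hLiu418 =
`stmt-HodgeConjecture-24832`, h413 = `stmt-HodgeConjecture-24833`) until rung 0 closes.

## References
* [MoeglinWaldspurger1995] C. Mœglin, J.-L. Waldspurger, *Spectral decomposition and Eisenstein series* (1995), IV.2.3, IV.3.12 (a).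
* [Arthur1980TraceFormulaII] J. Arthur, *A trace formula for reductive groups II*, Compositio Math. 40 (1980), §4.
* [BernsteinLapid2019] J. Bernstein, E. Lapid, *On the meromorphic continuation of Eisenstein series*, J. AMS 37 (2024), §4.
-/

set_option autoImplicit false
-- the mandated namespace repeats `HodgeConjecture.HodgeConjecture`, as in every `Theorems/*.lean` of this sub-problem
set_option linter.dupNamespace false

noncomputable section

open MeasureTheory MeasureTheory.Measure Set NumberField IsDedekindDomain Filter Topology Metric
open scoped NNReal ENNReal ComplexConjugate InnerProductSpace
open Literature.MeasureTheory.Group Literature.NumberTheory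
open Literature.NumberTheory.Automorphic Literature.NumberTheory.Automorphic.UnitaryGroup AdelicGroupData
open Summit.HodgeConjecture.HodgeConjecture.Cruxes.H413.K2E1BorelEisensteinU
open Summit.HodgeConjecture.HodgeConjecture.Cruxes.H413.K2E1BLBorelSpacesU2Defs
open Summit.HodgeConjecture.HodgeConjecture.Cruxes.H413.K2E1MaassSelbergContinuedCMTwo (differentiableOn_conj_comp_conj)
open Summit.HodgeConjecture.HodgeConjecture.Cruxes.H413.K2E1MaassSelbergPairingCMTwo (pairing_of_differentiableOn)
open Summit.HodgeConjecture.HodgeConjecture.Cruxes.H413.K2E1MaassSelbergPairingContinuedCMTwo (exists_fourTerm_tube_cm_two)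
open Summit.HodgeConjecture.HodgeConjecture.Cruxes.H413.K2E1MaassSelbergDiagonalFourTermCMTwo (diag_eq_fourTerm_of_pairing_on')

namespace Summit.HodgeConjecture.HodgeConjecture.Cruxes.H413.K2E1MaassSelbergDiagonalLowerCMTwo

/-! ## §1 Conjugating the four-term -/

/-- **`conj R(ū, ū′; c̃) = R(u, u′; conj ∘ c̃ ∘ conj)`** for the four-term of ★ `exists_fourTerm_tube_cm_two` (`T ≥ 0` and the brackets `cμ, K, κ, m` real). [cite: MoeglinWaldspurger1995, IV.2.3] -/
theorem conj_fourTerm_two (cμ K κ m : ℝ) {T : ℝ} (hT : 0 ≤ T) (φ₀ : ℂ) (c : ℂ → ℂ) (u u' : ℂ) :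
    conj (((cμ : ℝ) : ℂ) * (((K : ℝ) : ℂ) *
        ((((T : ℝ) : ℂ) ^ (conj u + conj (conj u') - 1) / (conj u + conj (conj u') - 1)) * (((κ : ℝ) : ℂ) * (((m : ℝ) : ℂ) * (φ₀ * conj φ₀)))
          + (((T : ℝ) : ℂ) ^ (conj u - conj (conj u')) / (conj u - conj (conj u'))) * (((κ : ℝ) : ℂ) * (((m : ℝ) : ℂ) * (φ₀ * conj (c (conj u') * φ₀))))
          - (((T : ℝ) : ℂ) ^ (-(conj u - conj (conj u'))) / (conj u - conj (conj u'))) * (((κ : ℝ) : ℂ) * (((m : ℝ) : ℂ) * (c (conj u) * φ₀ * conj φ₀)))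
          - (((T : ℝ) : ℂ) ^ (-(conj u + conj (conj u') - 1)) / (conj u + conj (conj u') - 1)) * (((κ : ℝ) : ℂ) * (((m : ℝ) : ℂ) * (c (conj u) * φ₀ * conj (c (conj u') * φ₀))))))) =
      ((cμ : ℝ) : ℂ) * (((K : ℝ) : ℂ) *
        ((((T : ℝ) : ℂ) ^ (u + conj u' - 1) / (u + conj u' - 1)) * (((κ : ℝ) : ℂ) * (((m : ℝ) : ℂ) * (φ₀ * conj φ₀)))
          + (((T : ℝ) : ℂ) ^ (u - conj u') / (u - conj u')) * (((κ : ℝ) : ℂ) * (((m : ℝ) : ℂ) * (φ₀ * conj (conj (c (conj u')) * φ₀))))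
          - (((T : ℝ) : ℂ) ^ (-(u - conj u')) / (u - conj u')) * (((κ : ℝ) : ℂ) * (((m : ℝ) : ℂ) * (conj (c (conj u)) * φ₀ * conj φ₀)))
          - (((T : ℝ) : ℂ) ^ (-(u + conj u' - 1)) / (u + conj u' - 1)) * (((κ : ℝ) : ℂ) * (((m : ℝ) : ℂ) * (conj (c (conj u)) * φ₀ * conj (conj (c (conj u')) * φ₀)))))) := by
  simp only [map_mul, map_add, map_sub, map_div₀, map_neg, map_one, Literature.NumberTheory.Automorphic.conj_ofReal_cpow hT, Complex.conj_ofReal, Complex.conj_conj]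
  ring

/-! ## §2 The diagonal identity on a lower-half-plane domain, by reflection -/

section Family

variable (L : Type) [Field L] [NumberField L] [IsCMField L]
variable [MeasurableSpace (quasiSplit (↥(maximalRealSubfield L)) L (IsCMField.complexConj L) 2).Adelic] [BorelSpace (quasiSplit (↥(maximalRealSubfield L)) L (IsCMField.complexConj L) 2).Adelic]
variable [MeasurableSpace (AdeleRing (𝓞 L) L)ˣ] [BorelSpace (AdeleRing (𝓞 L) L)ˣ]

/-- **`‖F ū‖² = R(u, u; conj ∘ c̃ ∘ conj)` FOR AN `L²`-HOLOMORPHIC FAMILY ON A LOWER-HALF-PLANE DOMAIN** — the binders of ★ `normSq_family_eq_fourTerm_on'` VERBATIM except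
`hD₁sub : D₁ ⊆ {½ < Re, Im < 0}`; conclusion for every `u` with `ū ∈ D₁`.  Proof: the reflected pairing `Φ′(u, u′) = ⟪F ū, F ū′⟫` on `D = conj⁻¹D₁ ⊆ D⁺` is holomorphic in `u`,
anti-holomorphic in `u′` (★ `pairing_of_differentiableOn`), equals `conj R(ū, ū′; c̃) = R(u, u′; c̃♯)` on the reflected boxes (★ `exists_fourTerm_tube_cm_two`, §1), so ★
`diag_eq_fourTerm_of_pairing_on'` applies on `D`. [cite: MoeglinWaldspurger1995, IV.2.3, IV.3.12 (a)] [cite: BernsteinLapid2019, §4] -/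
theorem normSq_family_eq_fourTerm_lower_on' {D₁ : Set ℂ} (hD₁ : IsOpen D₁) (hD₁c : IsPreconnected D₁) (hD₁sub : D₁ ⊆ {z : ℂ | 1 / 2 < z.re ∧ z.im < 0})
    {O₁ O₂' : Set ℂ} (hO₁ : IsOpen O₁) (hO₁ne : O₁.Nonempty) (hO₁D : O₁ ⊆ D₁) (hO₂' : IsOpen O₂') (hO₂'ne : O₂'.Nonempty) (hO₂'D : O₂' ⊆ D₁)
    (hsep : ∀ z ∈ O₁, ∀ z' ∈ O₂', 1 < z'.re ∧ z'.re < z.re)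
    (μ : Measure (quasiSplit (↥(maximalRealSubfield L)) L (IsCMField.complexConj L) 2).automorphicQuotient) [(quasiSplit (↥(maximalRealSubfield L)) L (IsCMField.complexConj L) 2).IsAutomorphicMeasure μ]
    (νG : Measure (quasiSplit (↥(maximalRealSubfield L)) L (IsCMField.complexConj L) 2).Adelic) [νG.IsHaarMeasure] [νG.IsInvInvariant]
    (μK : Measure ((standardMaximalCompactGL 2 L).comap (adelicVal (↥(maximalRealSubfield L)) L (IsCMField.complexConj L) 2 ((StdForm.antidiagonal 2).over L)) : Subgroup (quasiSplit (↥(maximalRealSubfield L)) L (IsCMField.complexConj L) 2).Adelic))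
    [μK.IsHaarMeasure]
    (νI : Measure (AdeleRing (𝓞 L) L)ˣ) [νI.IsHaarMeasure]
    {𝓕I : Set (AdeleRing (𝓞 L) L)ˣ} (h𝓕I : IsIdeleClassDomain L 𝓕I)
    (ν : Measure ↥(adelicUnipotent (↥(maximalRealSubfield L)) L (IsCMField.complexConj L) 2)) [ν.IsHaarMeasure]
    {𝓕 : Set ↥(adelicUnipotent (↥(maximalRealSubfield L)) L (IsCMField.complexConj L) 2)} (h𝓕N : IsFundamentalDomain ↥(rationalUnipotent (↥(maximalRealSubfield L)) L (IsCMField.complexConj L) 2) 𝓕 ν) (h𝓕1 : ν 𝓕 = 1)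
    (h𝓕c : IsCompact (closure 𝓕))
    {T : ℝ≥0} (hT : 1 ≤ T) {φ₀ : ℂ}
    {β : (quasiSplit (↥(maximalRealSubfield L)) L (IsCMField.complexConj L) 2).Adelic → ℝ≥0∞} (hβ : IsCoveringWeight ((arithmeticBorel (↥(maximalRealSubfield L)) L (IsCMField.complexConj L) 2).map (quasiSplit (↥(maximalRealSubfield L)) L (IsCMField.complexConj L) 2).arithmeticSubgroup.subtype) β)
    {c : ℂ → ℂ} (hc : DifferentiableOn ℂ c D₁) (hceq : ∀ z : ℂ, 1 < z.re → c z = (∫ v : ↥(adelicUnipotent (↥(maximalRealSubfield L)) L (IsCMField.complexConj L) 2), (((borelHeight ((quasiSplit (↥(maximalRealSubfield L)) L (IsCMField.complexConj L) 2).toAdelic (weylLongU ((IsCMField.complexConj L : L ≃ₐ[↥(maximalRealSubfield L)] L) : L →+* L) (rfl : (StdForm.antidiagonal 2).over L = (StdForm.antidiagonal 2).over L)) * (v : (quasiSplit (↥(maximalRealSubfield L)) L (IsCMField.complexConj L) 2).Adelic))) : ℝ) : ℂ) ^ z ∂ν))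
    (F : ℂ → Lp ℂ 2 μ) (hFd : DifferentiableOn ℂ F D₁)
    (hFtube : ∀ z ∈ D₁, 1 < z.re → ((F z : Lp ℂ 2 μ) : (quasiSplit (↥(maximalRealSubfield L)) L (IsCMField.complexConj L) 2).automorphicQuotient → ℂ) =ᵐ[μ] (quasiSplit (↥(maximalRealSubfield L)) L (IsCMField.complexConj L) 2).quotFun (truncation ν 𝓕 T (eisensteinSeriesU (flatSectionU (fun _ : (quasiSplit (↥(maximalRealSubfield L)) L (IsCMField.complexConj L) 2).Adelic => φ₀) z)))) :
    ∃ cμ K : ℝ, 0 < cμ ∧ 0 < K ∧ ∀ u : ℂ, conj u ∈ D₁ → (((‖F (conj u)‖ ^ 2 : ℝ)) : ℂ) =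
      ((cμ : ℝ) : ℂ) * (((K : ℝ) : ℂ) *
        ((((T : ℝ) : ℂ) ^ (u + conj u - 1) / (u + conj u - 1)) * ((((∫ x in {x : (AdeleRing (𝓞 L) L)ˣ | (IdeleClassGroup.ideleNorm L x : ℝ) ≤ 1} ∩ 𝓕I, (IdeleClassGroup.ideleNorm L x : ℝ) ∂νI) : ℝ) : ℂ) * (((μK.real Set.univ : ℝ) : ℂ) * (φ₀ * conj φ₀)))
          + (((T : ℝ) : ℂ) ^ (u - conj u) / (u - conj u)) * ((((∫ x in {x : (AdeleRing (𝓞 L) L)ˣ | (IdeleClassGroup.ideleNorm L x : ℝ) ≤ 1} ∩ 𝓕I, (IdeleClassGroup.ideleNorm L x : ℝ) ∂νI) : ℝ) : ℂ) * (((μK.real Set.univ : ℝ) : ℂ) * (φ₀ * conj (conj (c (conj u)) * φ₀))))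
          - (((T : ℝ) : ℂ) ^ (-(u - conj u)) / (u - conj u)) * ((((∫ x in {x : (AdeleRing (𝓞 L) L)ˣ | (IdeleClassGroup.ideleNorm L x : ℝ) ≤ 1} ∩ 𝓕I, (IdeleClassGroup.ideleNorm L x : ℝ) ∂νI) : ℝ) : ℂ) * (((μK.real Set.univ : ℝ) : ℂ) * (conj (c (conj u)) * φ₀ * conj φ₀)))
          - (((T : ℝ) : ℂ) ^ (-(u + conj u - 1)) / (u + conj u - 1)) * ((((∫ x in {x : (AdeleRing (𝓞 L) L)ˣ | (IdeleClassGroup.ideleNorm L x : ℝ) ≤ 1} ∩ 𝓕I, (IdeleClassGroup.ideleNorm L x : ℝ) ∂νI) : ℝ) : ℂ) * (((μK.real Set.univ : ℝ) : ℂ) * (conj (c (conj u)) * φ₀ * conj (conj (c (conj u)) * φ₀)))))) := by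
  -- the reflected domain `D = conj⁻¹ D₁ ⊆ D⁺`
  set D : Set ℂ := {u : ℂ | conj u ∈ D₁} with hDdef
  have hDo : IsOpen D := hD₁.preimage Complex.continuous_conj
  have hDc : IsPreconnected D := by
    have h1 : D = (fun z : ℂ => conj z) '' D₁ := by
      ext w
      refine ⟨fun hw => ⟨conj w, hw, Complex.conj_conj w⟩, ?_⟩
      rintro ⟨z, hz1, rfl⟩
      show conj (conj z) ∈ D₁
      rw [Complex.conj_conj]; exact hz1
    rw [h1]
    exact hD₁c.image _ Complex.continuous_conj.continuousOn
  have hDsub : D ⊆ {z : ℂ | 1 / 2 < z.re ∧ 0 < z.im} := fun u hu => by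
    obtain ⟨h1, h2⟩ := hD₁sub hu
    rw [Complex.conj_re] at h1
    rw [Complex.conj_im] at h2
    exact ⟨h1, by linarith⟩
  -- the reflected boxes
  have hP₁o : IsOpen {u : ℂ | conj u ∈ O₁} := hO₁.preimage Complex.continuous_conj
  have hP₁ne : ({u : ℂ | conj u ∈ O₁} : Set ℂ).Nonempty := by
    obtain ⟨z, hz⟩ := hO₁ne
    exact ⟨conj z, show conj (conj z) ∈ O₁ by rw [Complex.conj_conj]; exact hz⟩
  have hP₁D : {u : ℂ | conj u ∈ O₁} ⊆ D := fun u hu => hO₁D hu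
  have hP₂o : IsOpen {u : ℂ | conj u ∈ O₂'} := hO₂'.preimage Complex.continuous_conj
  have hP₂ne : ({u : ℂ | conj u ∈ O₂'} : Set ℂ).Nonempty := by
    obtain ⟨z, hz⟩ := hO₂'ne
    exact ⟨conj z, show conj (conj z) ∈ O₂' by rw [Complex.conj_conj]; exact hz⟩
  have hP₂D : {u : ℂ | conj u ∈ O₂'} ⊆ D := fun u hu => hO₂'D hu
  have hsep' : ∀ u ∈ {u : ℂ | conj u ∈ O₁}, ∀ u' ∈ {u : ℂ | conj u ∈ O₂'}, 1 < u'.re ∧ u'.re < u.re := fun u hu u' hu' => by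
    have h := hsep (conj u) hu (conj u') hu'
    rwa [Complex.conj_re, Complex.conj_re] at h
  -- the reflected scalar and the reflected pairing
  have hc' : DifferentiableOn ℂ (fun u : ℂ => conj (c (conj u))) D := differentiableOn_conj_comp_conj hD₁ hc
  obtain ⟨hΦ₁, hΦ₂, hQ⟩ := pairing_of_differentiableOn hD₁ hFd
  have hset : {w : ℂ | conj w ∈ D} = D₁ := by
    ext w
    simp only [hDdef, Set.mem_setOf_eq, Complex.conj_conj]
  have hΨ₁ : ∀ u' ∈ D, DifferentiableOn ℂ (fun u : ℂ => ⟪F (conj u), F (conj u')⟫_ℂ) D := fun u' hu' => hΦ₂ (conj u') hu'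
  have hΨ₂ : ∀ u ∈ D, DifferentiableOn ℂ (fun w : ℂ => ⟪F (conj u), F (conj (conj w))⟫_ℂ) {w : ℂ | conj w ∈ D} := fun u hu => by
    rw [hset]
    exact (hΦ₁ (conj u) hu).congr fun w _ => by rw [Complex.conj_conj]
  -- the tube four-term and the reflected relation on the boxes
  obtain ⟨cμ, K, hcμ, hK, h4⟩ := exists_fourTerm_tube_cm_two L μ νG μK νI h𝓕I ν h𝓕N h𝓕1 h𝓕c T hT φ₀ hβ c hceq
  have hT0 : (0 : ℝ) ≤ (T : ℝ) := T.coe_nonneg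
  have hrel : ∀ u ∈ D, ∀ u' ∈ D, 1 < u'.re → u'.re < u.re → ⟪F (conj u), F (conj u')⟫_ℂ =
      ((cμ : ℝ) : ℂ) * (((K : ℝ) : ℂ) *
        ((((T : ℝ) : ℂ) ^ (u + conj u' - 1) / (u + conj u' - 1)) * ((((∫ x in {x : (AdeleRing (𝓞 L) L)ˣ | (IdeleClassGroup.ideleNorm L x : ℝ) ≤ 1} ∩ 𝓕I, (IdeleClassGroup.ideleNorm L x : ℝ) ∂νI) : ℝ) : ℂ) * (((μK.real Set.univ : ℝ) : ℂ) * (φ₀ * conj φ₀)))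
          + (((T : ℝ) : ℂ) ^ (u - conj u') / (u - conj u')) * ((((∫ x in {x : (AdeleRing (𝓞 L) L)ˣ | (IdeleClassGroup.ideleNorm L x : ℝ) ≤ 1} ∩ 𝓕I, (IdeleClassGroup.ideleNorm L x : ℝ) ∂νI) : ℝ) : ℂ) * (((μK.real Set.univ : ℝ) : ℂ) * (φ₀ * conj (conj (c (conj u')) * φ₀))))
          - (((T : ℝ) : ℂ) ^ (-(u - conj u')) / (u - conj u')) * ((((∫ x in {x : (AdeleRing (𝓞 L) L)ˣ | (IdeleClassGroup.ideleNorm L x : ℝ) ≤ 1} ∩ 𝓕I, (IdeleClassGroup.ideleNorm L x : ℝ) ∂νI) : ℝ) : ℂ) * (((μK.real Set.univ : ℝ) : ℂ) * (conj (c (conj u)) * φ₀ * conj φ₀)))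
          - (((T : ℝ) : ℂ) ^ (-(u + conj u' - 1)) / (u + conj u' - 1)) * ((((∫ x in {x : (AdeleRing (𝓞 L) L)ˣ | (IdeleClassGroup.ideleNorm L x : ℝ) ≤ 1} ∩ 𝓕I, (IdeleClassGroup.ideleNorm L x : ℝ) ∂νI) : ℝ) : ℂ) * (((μK.real Set.univ : ℝ) : ℂ) * (conj (c (conj u)) * φ₀ * conj (conj (c (conj u')) * φ₀)))))) := by
    intro u hu u' hu' h1 h2
    have h1' : 1 < (conj u').re := by rwa [Complex.conj_re]
    have h2' : (conj u').re < (conj u).re := by rwa [Complex.conj_re, Complex.conj_re]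
    have hint : ⟪F (conj u), F (conj u')⟫_ℂ = conj (∫ x, (quasiSplit (↥(maximalRealSubfield L)) L (IsCMField.complexConj L) 2).quotFun (truncation ν 𝓕 T (eisensteinSeriesU (flatSectionU (fun _ : (quasiSplit (↥(maximalRealSubfield L)) L (IsCMField.complexConj L) 2).Adelic => φ₀) (conj u)))) x *
        conj ((quasiSplit (↥(maximalRealSubfield L)) L (IsCMField.complexConj L) 2).quotFun (truncation ν 𝓕 T (eisensteinSeriesU (flatSectionU (fun _ : (quasiSplit (↥(maximalRealSubfield L)) L (IsCMField.complexConj L) 2).Adelic => φ₀) (conj u')))) x) ∂μ) := by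
      rw [← integral_conj, MeasureTheory.L2.inner_def]
      refine integral_congr_ae ?_
      filter_upwards [hFtube (conj u) hu (h1'.trans h2'), hFtube (conj u') hu' h1'] with x hx hx'
      rw [hx, hx', RCLike.inner_apply, map_mul, Complex.conj_conj, mul_comm]
    rw [hint, h4 (conj u) (conj u') h1' h2']
    exact conj_fourTerm_two cμ K _ _ hT0 φ₀ c u u'
  refine ⟨cμ, K, hcμ, hK, fun u hu => ?_⟩
  rw [← (hQ (conj u) hu).2]
  exact diag_eq_fourTerm_of_pairing_on' hDo hDc hDsub hP₁o hP₁ne hP₁D hP₂o hP₂ne hP₂D hsep' (T := (T : ℝ)) (by exact_mod_cast hT) hc'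
    (Φ := fun u u' => ⟪F (conj u), F (conj u')⟫_ℂ) hΨ₁ hΨ₂ hrel hu

end Family

end Summit.HodgeConjecture.HodgeConjecture.Cruxes.H413.K2E1MaassSelbergDiagonalLowerCMTwo

end
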